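import Literature.Analysis.FluidPDE.SereginSverakOffAxisEpsilon
import Literature.Analysis.FluidPDE.LocalTypeI
import HarnessLib

/-!
# Seregin–Zajaczkowski 2007, Lemma 2.3: tools — `Q(z₀,1/4) ⊂ Q̂`, the Hölder step, the scaling

Proofs-only companion of `SereginZajaczkowski2007.lean` (G. Seregin, W. Zajaczkowski, SIAM J.
Math. Anal. 39 (2007) 669–685 = arXiv:math/0702720, numbers of the arXiv version) serving the
reduction of the named fact `L6EpsilonRegularity` (Lemma 2.3) to the inputs of its printed proof,
carried out in `SereginZajaczkowski2007Lemma23.lean` (which see for the printed proof and the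
plan). No definitions. Contents:

* geometry ("First, we remark `Q(z₀, 1/4) ⊂ Q̂` for any `z₀ ∈ 𝒞(1,2;1) × ]-1,0[`", p. 3): the
  closed boxes `[t₀ - r², t₀] × B̄(x₀, r)`, `r ≤ 1/4`, and the ball cylinders
  `Q_r(z₀) = ]t₀ - r², t₀[ × B(x₀, r)` hanging from such centres lie in
  `Q̂ = 𝒞(3/4, 9/4; 3/2) × ]-(3/2)², 0[` (the printed `Q(z₀, r)` have the flat cylinders
  `𝒞(x₀, r) ⊇ B(x₀, r)` as sections; the proof runs verbatim with balls, which are the sections of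
  the cylinders of (2.2) in [S2] and of the ε-regularity lemmas [LS, ESS4, S8]);
* the Hölder step of (2.8), `C(s²; z₀) ≤ (|B₁| m)^{1/2} s` from `∫_Q̂ |v|⁶ ≤ m`, and
  `D(1/4; z₀) ≤ 16 𝒜_*` from `∫_Q̂ |p|^{3/2} ≤ 𝒜_*` (ball versions of the accepted
  `cknC_le_of_sixth_bound`, `cknD_quarter_le_of_bound` of the twin reduction
  `SereginSverakOffAxisTools.lean`, whose data live on `Q̃₂`, `Q̃` instead of `Q̂`);
* **the Navier–Stokes scaling `Q_ρ(z₀) → Q = Q(0,1)`** ("by the Navier–Stokes equations scaling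
  … we may define suitable weak solutions … in `Q(z₀, R)`", §2 p. 2; "Lemma 6.1 and the
  Navier–Stokes scaling", Seregin 2014 p. 100): for a suitable weak solution `(v, p)` in `Q̂` with
  the classes of Def. 1.1, an admissible centre and `0 < ρ ≤ 1/4`, the pair
  `w(s, y) = ρ v(t₀ + ρ² s, x₀ + ρ y)`, `q = ρ² p ∘ Φ` belongs to the accepted class
  `IsSuitableWeakSolutionInBall 1 0` (Seregin's Def. 6.1 as rendered in `LocalTypeI.lean`), with
  weak gradient `ρ² ∇v ∘ Φ` and smallness quantity `∫_Q (|w|³ + |q|^{3/2}) = C(ρ; z₀) + D(ρ; z₀)`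
  (accepted covariances `IsSuitableWeakSolutionOn.stRescale`, `HasWeakSpatialGradientOn.stRescale`
  and change-of-variables lemmas of `SpaceTimeRescaling.lean`, `NSSuitableESS.lean`);
* the gradient half of the last step of the proof — "`|∇v(z₀)| ≤ c/r₀²`" — from the ε-regularity
  bound for the gradient on the unit cylinder in a.e. form (hypothesis `H`, the shape of
  `seregin2014_lemma61_gradient.ae_bound`, Seregin 2014 Lemma 6.1 `k = 2`), transported back
  along `Φ` (`ae_gradient_bound_of_lemma61`).

## References

* G. Seregin, W. Zajaczkowski, SIAM J. Math. Anal. 39 (2007) 669–685, arXiv:math/0702720: §2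
  (scaling, (2.2), Lemma 2.3 and its proof, pp. 2–4). [`SereginZajaczkowski2007`]
* G. Seregin, *Lecture Notes on Regularity Theory for the Navier–Stokes Equations* (2014), Ch. 6,
  Lemma 6.1 (p. 90), p. 100. [`Seregin2014`]
* G. Seregin, V. Šverák, arXiv:0804.1803, proof of Prop. 3.7 (the twin reduction in the tree,
  `SereginSverakOffAxisEpsilon.lean`). [`SereginSverak2009`]
-/

noncomputable section

open MeasureTheory Set Function Filter Topology TopologicalSpace Module Metric
open scoped NNReal ENNReal

namespace Literature.Analysis.FluidPDE

namespace SereginZajaczkowski2007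

open SereginSverak2009

/-! ### Geometry: `Q(z₀, 1/4) ⊂ Q̂` in ball form -/

section Geometry

variable {z₀ : ℝ × (EuclideanSpace ℝ (Fin 3))} {r : ℝ}

/-- For `z₀ ∈ 𝒞(1,2;1) × ]-1,0[` and `0 < r ≤ 1/4`, the closed box `[t₀ - r², t₀] × B̄(x₀, r)`
lies in `Q̂ = 𝒞(3/4, 9/4; 3/2) × ]-(3/2)², 0[` ("`Q(z₀, 1/4) ⊂ Q̂`", with closures: `|x'|` moves
by at most `‖x - x₀‖ ≤ 1/4` away from `]1, 2[`, `|x₃|` by at most `1/4` away from `[0, 1[`, and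
`-1 - 1/16 > -9/4`). [cite: SereginZajaczkowski2007, proof of Lemma 2.3 (arXiv p. 3)] -/
theorem closedBox_subset_shellCyl_hat (h₀ : z₀ ∈ shellCyl 1 2 1 1) (hr : r ≤ 1 / 4) :
    Icc (z₀.1 - r ^ 2) z₀.1 ×ˢ closedBall z₀.2 r ⊆ shellCyl (3 / 4) (9 / 4) (3 / 2) (3 / 2) := by
  intro z hz
  obtain ⟨⟨ht1, ht2⟩, hx⟩ := hz
  rw [mem_closedBall, dist_eq_norm] at hx
  obtain ⟨⟨ht01, ht02⟩, ⟨hc1, hc2⟩, hx3⟩ := mem_shellCyl.1 h₀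
  norm_num at ht01
  have hr2 : r ^ 2 ≤ 1 / 16 := by
    have hr0 : 0 ≤ r := (norm_nonneg _).trans hx
    nlinarith
  have hcyl : cylRadius (z.2 - z₀.2) ≤ 1 / 4 := ((cylRadius_le_norm' _).trans hx).trans hr
  have hcyl' : cylRadius (z₀.2 - z.2) ≤ 1 / 4 := by rwa [cylRadius_sub_comm]
  have h3 : |z.2 2 - z₀.2 2| ≤ 1 / 4 := by
    have h := PiLp.norm_apply_le (z.2 - z₀.2) 2
    rw [PiLp.sub_apply, Real.norm_eq_abs] at h
    exact (h.trans hx).trans hr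
  rw [mem_shellCyl]
  refine ⟨⟨by nlinarith, lt_of_le_of_lt ht2 ht02⟩, ⟨?_, ?_⟩, ?_⟩
  · have := cylRadius_le_cylRadius_add z₀.2 z.2
    linarith
  · have := cylRadius_le_cylRadius_add z.2 z₀.2
    linarith
  · have h5 : |z.2 2| ≤ |z.2 2 - z₀.2 2| + |z₀.2 2| := by
      calc |z.2 2| = |z.2 2 - z₀.2 2 + z₀.2 2| := by rw [sub_add_cancel]
        _ ≤ |z.2 2 - z₀.2 2| + |z₀.2 2| := abs_add_le _ _
    linarith

/-- Hence the ball cylinders `Q_r(z₀) = ]t₀ - r², t₀[ × B(x₀, r)`, `r ≤ 1/4`, lie in `Q̂`.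
[cite: SereginZajaczkowski2007, proof of Lemma 2.3 (arXiv p. 3)] -/
theorem parabolicCylinder_subset_shellCyl_hat (h₀ : z₀ ∈ shellCyl 1 2 1 1) (hr : r ≤ 1 / 4) :
    parabolicCylinder r z₀ ⊆ shellCyl (3 / 4) (9 / 4) (3 / 2) (3 / 2) := fun _ hz =>
  closedBox_subset_shellCyl_hat h₀ hr ⟨Ioo_subset_Icc_self hz.1, ball_subset_closedBall hz.2⟩

/-- The same inclusion for the open sets. [cite: SereginZajaczkowski2007, proof of Lemma 2.3 (arXiv p. 3)] -/
theorem parabolicCylinderOpens_le_shellCylOpens_hat (h₀ : z₀ ∈ shellCyl 1 2 1 1) (hr : r ≤ 1 / 4) :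
    parabolicCylinderOpens r z₀ ≤ shellCylOpens (3 / 4) (9 / 4) (3 / 2) (3 / 2) :=
  parabolicCylinder_subset_shellCyl_hat h₀ hr

/-- The balls `B(x₀, r)`, `0 < r ≤ 1/4`, lie in the shell `𝒞(3/4, 9/4; 3/2)`. [folklore] -/
theorem ball_subset_shell_hat (h₀ : z₀ ∈ shellCyl 1 2 1 1) (hr0 : 0 < r) (hr : r ≤ 1 / 4) :
    ball z₀.2 r ⊆ shell (3 / 4) (9 / 4) (3 / 2) := by
  intro x hx
  have ht : z₀.1 - r ^ 2 / 2 ∈ Ioo (z₀.1 - r ^ 2) z₀.1 := ⟨by nlinarith, by nlinarith⟩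
  have hz : ((z₀.1 - r ^ 2 / 2, x) : ℝ × (EuclideanSpace ℝ (Fin 3))) ∈ parabolicCylinder r z₀ := ⟨ht, hx⟩
  exact (mem_shellCyl.1 (parabolicCylinder_subset_shellCyl_hat h₀ hr hz)).2

/-- The time intervals `]t₀ - r², t₀[`, `r ≤ 1/4`, lie in `]-(3/2)², 0[`. [folklore] -/
theorem Ioo_subset_Ioo_hat (h₀ : z₀ ∈ shellCyl 1 2 1 1) (hr0 : 0 < r) (hr : r ≤ 1 / 4) :
    Ioo (z₀.1 - r ^ 2) z₀.1 ⊆ Ioo (-(3 / 2 : ℝ) ^ 2) 0 := by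
  obtain ⟨⟨ht01, ht02⟩, -, -⟩ := mem_shellCyl.1 h₀
  norm_num at ht01
  have hr2 : r ^ 2 ≤ 1 / 16 := by nlinarith
  exact Ioo_subset_Ioo (by nlinarith) ht02.le

end Geometry

/-! ### The Hölder step and `D(1/4; z₀)` from the data on `Q̂` -/

section Data

variable {z₀ : ℝ × (EuclideanSpace ℝ (Fin 3))} {v : ℝ → (EuclideanSpace ℝ (Fin 3)) → (EuclideanSpace ℝ (Fin 3))} {p : ℝ → (EuclideanSpace ℝ (Fin 3)) → ℝ}

/-- **The Hölder step** ("It follows from … Hölder's inequality, and (2.6) that …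
`(r₁/r)² m^{1/2} r₁^{1/2}`", arXiv p. 3), in ball form and from the data on `Q̂`: `∫_Q̂ |v|⁶ ≤ m`
gives `C(s²; z₀) ≤ (|B₁| m)^{1/2} s` for `s² ≤ 1/4`, because `Q_{s²}(z₀) ⊆ Q̂` and
`|Q_{s²}(z₀)| = s^{10} |B₁|` (accepted `setLIntegral_cube_le`, `volume_parabolicCylinder_eq`).
[cite: SereginZajaczkowski2007, proof of Lemma 2.3 ((2.8), arXiv p. 3)] -/
theorem cknC_le_of_sixth_bound_hat {m : ℝ≥0∞}
    (hv : AEStronglyMeasurable (uncurry v)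
      (volume.restrict (shellCyl (3 / 4) (9 / 4) (3 / 2) (3 / 2))))
    (h6 : ∫⁻ z in shellCyl (3 / 4) (9 / 4) (3 / 2) (3 / 2), ‖v z.1 z.2‖ₑ ^ (6 : ℕ) ≤ m)
    (h₀ : z₀ ∈ shellCyl 1 2 1 1) {s : ℝ} (hs : 0 < s) (hs4 : s ^ 2 ≤ 1 / 4) :
    cknC (s ^ 2) z₀ v ≤ (volume (ball (0 : (EuclideanSpace ℝ (Fin 3))) 1) * m) ^ (2⁻¹ : ℝ) * ENNReal.ofReal s := by
  set S := parabolicCylinder (s ^ 2) z₀ with hS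
  have hSQ : S ⊆ shellCyl (3 / 4) (9 / 4) (3 / 2) (3 / 2) :=
    parabolicCylinder_subset_shellCyl_hat h₀ hs4
  have hmeas : AEMeasurable (fun z : ℝ × (EuclideanSpace ℝ (Fin 3)) => ‖v z.1 z.2‖ₑ) (volume.restrict S) :=
    (hv.mono_measure (Measure.restrict_mono hSQ le_rfl)).enorm
  have h1 := setLIntegral_cube_le hmeas
  have h2 : (∫⁻ z in S, ‖v z.1 z.2‖ₑ ^ (6 : ℕ)) ^ (2⁻¹ : ℝ) ≤ m ^ (2⁻¹ : ℝ) :=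
    ENNReal.rpow_le_rpow ((lintegral_mono_set hSQ).trans h6) (by norm_num)
  have h3 : volume S ^ (2⁻¹ : ℝ) = volume (ball (0 : (EuclideanSpace ℝ (Fin 3))) 1) ^ (2⁻¹ : ℝ) * ENNReal.ofReal (s ^ 5) := by
    rw [hS, volume_parabolicCylinder_eq z₀ (by positivity), show (s ^ 2) ^ 5 = s ^ 10 by ring,
      ENNReal.mul_rpow_of_nonneg _ _ (by norm_num), ofReal_pow_ten_rpow_half hs.le, mul_comm]
  have h4 : ∫⁻ z in S, ‖v z.1 z.2‖ₑ ^ (3 : ℕ) ≤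
      m ^ (2⁻¹ : ℝ) * (volume (ball (0 : (EuclideanSpace ℝ (Fin 3))) 1) ^ (2⁻¹ : ℝ) * ENNReal.ofReal (s ^ 5)) :=
    h1.trans (by rw [h3]; exact mul_le_mul' h2 le_rfl)
  unfold cknC
  rw [← hS]
  calc (ENNReal.ofReal (s ^ 2) ^ 2)⁻¹ * ∫⁻ z in S, ‖v z.1 z.2‖ₑ ^ (3 : ℕ)
      ≤ (ENNReal.ofReal (s ^ 2) ^ 2)⁻¹ * (m ^ (2⁻¹ : ℝ) *
          (volume (ball (0 : (EuclideanSpace ℝ (Fin 3))) 1) ^ (2⁻¹ : ℝ) * ENNReal.ofReal (s ^ 5))) :=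
        mul_le_mul' le_rfl h4
    _ = (volume (ball (0 : (EuclideanSpace ℝ (Fin 3))) 1) * m) ^ (2⁻¹ : ℝ) * ENNReal.ofReal s := by
        rw [ofReal_pow_inv (by positivity : 0 < s ^ 2) 2, ENNReal.mul_rpow_of_nonneg _ m (by norm_num)]
        have e4 : ENNReal.ofReal (((s ^ 2) ^ 2)⁻¹) * ENNReal.ofReal (s ^ 5) = ENNReal.ofReal s := by
          rw [← ENNReal.ofReal_mul (by positivity)]
          congr 1
          field_simp
        calc ENNReal.ofReal (((s ^ 2) ^ 2)⁻¹) * (m ^ (2⁻¹ : ℝ) *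
              (volume (ball (0 : (EuclideanSpace ℝ (Fin 3))) 1) ^ (2⁻¹ : ℝ) * ENNReal.ofReal (s ^ 5)))
            = volume (ball (0 : (EuclideanSpace ℝ (Fin 3))) 1) ^ (2⁻¹ : ℝ) * m ^ (2⁻¹ : ℝ) *
                (ENNReal.ofReal (((s ^ 2) ^ 2)⁻¹) * ENNReal.ofReal (s ^ 5)) := by ring
          _ = volume (ball (0 : (EuclideanSpace ℝ (Fin 3))) 1) ^ (2⁻¹ : ℝ) * m ^ (2⁻¹ : ℝ) * ENNReal.ofReal s := by
                rw [e4]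

/-- `D(1/4; z₀) ≤ 16 𝒜_*` when `∫_Q̂ |p|^{3/2} ≤ 𝒜_*` (`Q_{1/4}(z₀) ⊆ Q̂`).
[cite: SereginZajaczkowski2007, proof of Lemma 2.3 (D(z₀,1/4;p) ≤ c𝒜_*, arXiv p. 3)] -/
theorem cknD_quarter_le_of_hat (h₀ : z₀ ∈ shellCyl 1 2 1 1) {a : ℝ≥0}
    (ha : ∫⁻ z in shellCyl (3 / 4) (9 / 4) (3 / 2) (3 / 2), ‖p z.1 z.2‖ₑ ^ (3 / 2 : ℝ) ≤ a) :
    cknD (1 / 4) z₀ p ≤ ((16 * a : ℝ≥0) : ℝ≥0∞) := by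
  have e16 : (ENNReal.ofReal (1 / 4 : ℝ) ^ 2)⁻¹ = 16 := by
    rw [ofReal_pow_inv (by norm_num : (0 : ℝ) < 1 / 4) 2]
    norm_num
  unfold cknD
  rw [e16]
  push_cast
  exact mul_le_mul' le_rfl
    ((lintegral_mono_set (parabolicCylinder_subset_shellCyl_hat h₀ le_rfl)).trans ha)

end Data

/-! ### The Navier–Stokes scaling `Q_ρ(z₀) → Q(0, 1)` -/

section Rescale

variable {z₀ : ℝ × (EuclideanSpace ℝ (Fin 3))} {ρ : ℝ} {v : ℝ → (EuclideanSpace ℝ (Fin 3)) → (EuclideanSpace ℝ (Fin 3))} {p : ℝ → (EuclideanSpace ℝ (Fin 3)) → ℝ} {G : ℝ → (EuclideanSpace ℝ (Fin 3)) → (EuclideanSpace ℝ (Fin 3)) →L[ℝ] (EuclideanSpace ℝ (Fin 3))}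

/-- `Φ⁻¹(Q_r(z₀)) = Q(r/ρ)` for `Φ(s, y) = (t₀ + ρ² s, x₀ + ρ y)` (accepted
`stAffine_preimage_cylinder_eq_parabolicCylinder` at `ν = 1`). [folklore] -/
theorem stAffine_sq_preimage_parabolicCylinder (hρ : 0 < ρ) (z₀ : ℝ × (EuclideanSpace ℝ (Fin 3))) (r : ℝ) :
    stAffine (ρ ^ 2) ρ z₀.1 z₀.2 ⁻¹' parabolicCylinder r z₀ =
      parabolicCylinder (r / ρ) ((0 : ℝ), (0 : (EuclideanSpace ℝ (Fin 3)))) := by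
  have h := stAffine_preimage_cylinder_eq_parabolicCylinder one_pos hρ z₀.1 z₀.2 r
  simp only [div_one] at h
  exact h

/-- `Φ⁻¹(Q_ρ(z₀)) = Q = Q(0, 1)`. [folklore] -/
theorem stAffine_sq_preimage_self (hρ : 0 < ρ) (z₀ : ℝ × (EuclideanSpace ℝ (Fin 3))) :
    stAffine (ρ ^ 2) ρ z₀.1 z₀.2 ⁻¹' parabolicCylinder ρ z₀ =
      parabolicCylinder 1 ((0 : ℝ), (0 : (EuclideanSpace ℝ (Fin 3)))) := by
  rw [stAffine_sq_preimage_parabolicCylinder hρ, div_self hρ.ne']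

/-- `Φ⁻¹(Q_{ρ/2}(z₀)) = Q(1/2)`. [folklore] -/
theorem stAffine_sq_preimage_half (hρ : 0 < ρ) (z₀ : ℝ × (EuclideanSpace ℝ (Fin 3))) :
    stAffine (ρ ^ 2) ρ z₀.1 z₀.2 ⁻¹' parabolicCylinder (ρ / 2) z₀ =
      parabolicCylinder (1 / 2) ((0 : ℝ), (0 : (EuclideanSpace ℝ (Fin 3)))) := by
  rw [stAffine_sq_preimage_parabolicCylinder hρ]
  congr 1
  field_simp

/-- `Φ⁻¹(Q_ρ(z₀)) = Q` as open sets. [folklore] -/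
theorem stPreimage_sq_parabolicCylinderOpens (hρ : 0 < ρ) (z₀ : ℝ × (EuclideanSpace ℝ (Fin 3))) :
    stPreimage (ρ ^ 2) ρ z₀.1 z₀.2 (parabolicCylinderOpens ρ z₀) =
      parabolicCylinderOpens 1 ((0 : ℝ), (0 : (EuclideanSpace ℝ (Fin 3)))) :=
  TopologicalSpace.Opens.ext (stAffine_sq_preimage_self hρ z₀)

/-- **The smallness quantity under the scaling** ("Lemma 6.1 and the Navier–Stokes scaling",
Seregin 2014 p. 100): `∫_Q (|w|³ + |q|^{3/2}) = ρ⁻² ∫_{Q_ρ(z₀)} (|v|³ + |p|^{3/2}) = C(ρ; z₀) +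
D(ρ; z₀)` for `w = ρ v ∘ Φ`, `q = ρ² p ∘ Φ` (accepted `lintegral_cubic_add_pressure_stRescale` at
`ν = 1`). [folklore] -/
theorem lintegral_cubic_add_pressure_sq_rescale (hρ : 0 < ρ) (z₀ : ℝ × (EuclideanSpace ℝ (Fin 3))) (v : ℝ → (EuclideanSpace ℝ (Fin 3)) → (EuclideanSpace ℝ (Fin 3)))
    (p : ℝ → (EuclideanSpace ℝ (Fin 3)) → ℝ) :
    ∫⁻ z in parabolicCylinder 1 ((0 : ℝ), (0 : (EuclideanSpace ℝ (Fin 3)))),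
        (‖(ρ • stPull (ρ ^ 2) ρ z₀.1 z₀.2 v) z.1 z.2‖ₑ ^ (3 : ℕ) +
          ‖(ρ ^ 2 • stPull (ρ ^ 2) ρ z₀.1 z₀.2 p) z.1 z.2‖ₑ ^ (3 / 2 : ℝ)) =
      ENNReal.ofReal ((ρ ^ 2)⁻¹) *
        ∫⁻ z in parabolicCylinder ρ z₀, (‖v z.1 z.2‖ₑ ^ (3 : ℕ) + ‖p z.1 z.2‖ₑ ^ (3 / 2 : ℝ)) := by
  have h := lintegral_cubic_add_pressure_stRescale one_pos hρ z₀.1 z₀.2 v p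
  simp only [div_one, one_pow, one_mul, viscousCylinder_one] at h
  exact h

/-- **The rescaled pair is a suitable weak solution in `Q = Q(0,1)` in the class of Lemma 6.1.**
For a suitable weak solution `(v, p)` in `Q̂` with Def. 1.1's classes (`v ∈ L_{2,∞}(Q̂)`, a weak
gradient `G` with `∫_Q̂ |G|² < ∞`, `p ∈ L_{3/2}(Q̂)`), a centre `z₀ ∈ 𝒞(1,2;1) × ]-1,0[` and
`0 < ρ ≤ 1/4`, the pair `w(s, y) = ρ v(t₀ + ρ²s, x₀ + ρy)`, `q = ρ² p ∘ Φ` belongs to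
`IsSuitableWeakSolutionInBall 1 0` (suitable on `Q = Φ⁻¹(Q_ρ(z₀))` by the accepted covariance
`IsSuitableWeakSolutionOn.stRescale`; the global classes on `Q` are those of `(v, p)` on
`Q_ρ(z₀) ⊆ Q̂` transported along `Φ`), and `ρ² G ∘ Φ` is a weak gradient of `w` on `Q`
(`HasWeakSpatialGradientOn.stRescale`) — the Navier–Stokes scaling under which "we may define
suitable weak solutions … in `Q(z₀, R)`" (§2, p. 2). [cite: SereginZajaczkowski2007, §2 (the Navier–Stokes scaling, arXiv p. 2) and proof of Lemma 2.3 (p. 3)] -/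
theorem isSuitableWeakSolutionInBall_rescale
    (hsws : IsSuitableWeakSolutionOn (shellCylOpens (3 / 4) (9 / 4) (3 / 2) (3 / 2)) 1 0 v p)
    (hG : HasWeakSpatialGradientOn (shellCylOpens (3 / 4) (9 / 4) (3 / 2) (3 / 2)) v G)
    (hA : ∃ C : ℝ≥0, ∀ᵐ t ∂(volume.restrict (Ioo (-(3 / 2 : ℝ) ^ 2) 0)),
      ∫⁻ x in shell (3 / 4) (9 / 4) (3 / 2), ‖v t x‖ₑ ^ 2 ≤ C)
    (hE : ∫⁻ z in shellCyl (3 / 4) (9 / 4) (3 / 2) (3 / 2),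
      ENNReal.ofReal (frobeniusNormSq (G z.1 z.2)) < ⊤)
    (hP : ∫⁻ z in shellCyl (3 / 4) (9 / 4) (3 / 2) (3 / 2), ‖p z.1 z.2‖ₑ ^ (3 / 2 : ℝ) < ⊤)
    (h₀ : z₀ ∈ shellCyl 1 2 1 1) (hρ : 0 < ρ) (hρ4 : ρ ≤ 1 / 4) :
    IsSuitableWeakSolutionInBall 1 ((0 : ℝ), (0 : (EuclideanSpace ℝ (Fin 3)))) (ρ • stPull (ρ ^ 2) ρ z₀.1 z₀.2 v)
        (ρ ^ 2 • stPull (ρ ^ 2) ρ z₀.1 z₀.2 p) ∧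
      HasWeakSpatialGradientOn (parabolicCylinderOpens 1 ((0 : ℝ), (0 : (EuclideanSpace ℝ (Fin 3)))))
        (ρ • stPull (ρ ^ 2) ρ z₀.1 z₀.2 v) ((ρ * ρ) • stPull (ρ ^ 2) ρ z₀.1 z₀.2 G) := by
  have hρ2 : 0 < ρ ^ 2 := by positivity
  have hsubQ : parabolicCylinder ρ z₀ ⊆ shellCyl (3 / 4) (9 / 4) (3 / 2) (3 / 2) :=
    parabolicCylinder_subset_shellCyl_hat h₀ hρ4
  have hle : parabolicCylinderOpens ρ z₀ ≤ shellCylOpens (3 / 4) (9 / 4) (3 / 2) (3 / 2) := hsubQ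
  have hpre := stAffine_sq_preimage_self hρ z₀
  have hpreO := stPreimage_sq_parabolicCylinderOpens hρ z₀
  have hfin : ENNReal.ofReal (ρ ^ 2 * ρ ^ finrank ℝ (EuclideanSpace ℝ (Fin 3)))⁻¹ ≠ ∞ := ENNReal.ofReal_ne_top
  -- the weak gradient of the rescaled field
  have hG' : HasWeakSpatialGradientOn (parabolicCylinderOpens 1 ((0 : ℝ), (0 : (EuclideanSpace ℝ (Fin 3)))))
      (ρ • stPull (ρ ^ 2) ρ z₀.1 z₀.2 v) ((ρ * ρ) • stPull (ρ ^ 2) ρ z₀.1 z₀.2 G) := by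
    have h1 := (hG.mono hle).stRescale ρ hρ2 hρ z₀.1 z₀.2
    rwa [hpreO] at h1
  have hG'2 : ∫⁻ w in parabolicCylinder 1 ((0 : ℝ), (0 : (EuclideanSpace ℝ (Fin 3)))),
      ENNReal.ofReal (frobeniusNormSq (((ρ * ρ) • stPull (ρ ^ 2) ρ z₀.1 z₀.2 G) w.1 w.2)) < ∞ := by
    rw [← hpre, setLIntegral_frobeniusNormSq_stRescale hρ2 hρ]
    exact ENNReal.mul_lt_top (ENNReal.mul_lt_top ENNReal.ofReal_lt_top hfin.lt_top)
      ((lintegral_mono_set hsubQ).trans_lt hE)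
  refine ⟨⟨?_, ?_, ⟨_, hG', hG'2⟩, ?_⟩, hG'⟩
  · -- suitability on `Q`, by covariance
    have key := (hsws.of_le hle).stRescale (α := ρ) (β := ρ ^ 2) (γ := ρ) hρ hρ (by ring)
      z₀.1 z₀.2
    have hν : ρ * 1 / ρ = 1 := by field_simp
    have hf : ((ρ ^ 2 * ρ) • stPull (ρ ^ 2) ρ z₀.1 z₀.2 (0 : ℝ → (EuclideanSpace ℝ (Fin 3)) → (EuclideanSpace ℝ (Fin 3)))) = 0 := by
      funext s y
      simp [stPull]
    rw [hν, hf, hpreO] at key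
    exact key
  · -- `w ∈ L_{2,∞}(Q)`
    obtain ⟨C, hC⟩ := hA
    have h1 : ∀ᵐ t ∂(volume.restrict (Ioo (z₀.1 + ρ ^ 2 * (-1)) (z₀.1 + ρ ^ 2 * 0))),
        ∫⁻ x in ball z₀.2 ρ, ‖v t x‖ₑ ^ 2 ≤ C := by
      have e : Ioo (z₀.1 + ρ ^ 2 * (-1)) (z₀.1 + ρ ^ 2 * 0) = Ioo (z₀.1 - ρ ^ 2) z₀.1 := by
        congr 1 <;> ring
      rw [e]
      filter_upwards [ae_restrict_of_ae_restrict_of_subset (Ioo_subset_Ioo_hat h₀ hρ hρ4) hC]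
        with t ht
      exact (lintegral_mono_set (ball_subset_shell_hat h₀ hρ hρ4)).trans ht
    have h2 := ae_sliced_setLIntegral_ball_stRescale hρ2 hρ z₀.1 z₀.2 z₀.2 ρ (-1) 0
      (fun t x => ‖v t x‖ₑ ^ 2) h1
    have hball : ball (ρ⁻¹ • (z₀.2 - z₀.2)) (ρ / ρ) = ball (0 : (EuclideanSpace ℝ (Fin 3))) 1 := by
      rw [sub_self, smul_zero, div_self hρ.ne']
    rw [hball] at h2
    have hI' : Ioo (((0 : ℝ), (0 : (EuclideanSpace ℝ (Fin 3)))).1 - 1 ^ 2) ((0 : ℝ), (0 : (EuclideanSpace ℝ (Fin 3)))).1 = Ioo (-1) 0 := by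
      norm_num
    rw [hI']
    refine exists_nnreal_of_ae_le (K := ‖ρ‖ₑ ^ 2 * (ENNReal.ofReal (ρ ^ finrank ℝ (EuclideanSpace ℝ (Fin 3)))⁻¹ * C))
      (ENNReal.mul_ne_top (by simp) (ENNReal.mul_ne_top ENNReal.ofReal_ne_top ENNReal.coe_ne_top)) ?_
    filter_upwards [h2] with s hs
    have e : ∀ y : (EuclideanSpace ℝ (Fin 3)), ‖(ρ • stPull (ρ ^ 2) ρ z₀.1 z₀.2 v) s y‖ₑ ^ 2 =
        ‖ρ‖ₑ ^ 2 * ‖v (z₀.1 + ρ ^ 2 * s) (z₀.2 + ρ • y)‖ₑ ^ 2 := by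
      intro y
      rw [smul_stPull_apply, enorm_smul, mul_pow]
    simp_rw [e]
    rw [lintegral_const_mul' _ _ (by simp)]
    exact mul_le_mul_right hs _
  · -- `q ∈ L_{3/2}(Q)`
    have hp_loc : LocallyIntegrableOn (uncurry p)
        ((shellCylOpens (3 / 4) (9 / 4) (3 / 2) (3 / 2) : Opens (ℝ × (EuclideanSpace ℝ (Fin 3)))) : Set (ℝ × (EuclideanSpace ℝ (Fin 3)))) volume :=
      hsws.distributional.2.2.1
    have hmeas : AEStronglyMeasurable (uncurry (ρ ^ 2 • stPull (ρ ^ 2) ρ z₀.1 z₀.2 p))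
        (volume.restrict (parabolicCylinder 1 ((0 : ℝ), (0 : (EuclideanSpace ℝ (Fin 3)))))) := by
      have h1 := (hp_loc.mono_set hsubQ).comp_stAffine hρ2 hρ z₀.1 z₀.2
      rw [hpre] at h1
      have h2 := h1.aestronglyMeasurable.const_smul (ρ ^ 2)
      have e : uncurry (ρ ^ 2 • stPull (ρ ^ 2) ρ z₀.1 z₀.2 p) =
          (ρ ^ 2) • (uncurry p ∘ stAffine (ρ ^ 2) ρ z₀.1 z₀.2) := by
        funext z
        rfl
      rw [e]
      exact h2
    refine ⟨hmeas, ?_⟩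
    rw [eLpNorm_lt_top_iff_lintegral_rpow_enorm_lt_top (by norm_num)
      (ENNReal.div_lt_top (by simp) (by simp)).ne]
    have e32 : ((3 / 2 : ℝ≥0∞)).toReal = (3 / 2 : ℝ) := by
      rw [ENNReal.toReal_div]
      norm_num
    rw [e32]
    show ∫⁻ z in parabolicCylinder 1 ((0 : ℝ), (0 : (EuclideanSpace ℝ (Fin 3)))),
      ‖(ρ ^ 2 • stPull (ρ ^ 2) ρ z₀.1 z₀.2 p) z.1 z.2‖ₑ ^ (3 / 2 : ℝ) < ∞
    rw [← hpre, setLIntegral_enorm_rpow_stRescale hρ2 hρ z₀.1 z₀.2 (ρ ^ 2) p _ (by norm_num)]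
    exact ENNReal.mul_lt_top (ENNReal.mul_lt_top
      (ENNReal.rpow_lt_top_of_nonneg (by norm_num) enorm_ne_top) hfin.lt_top)
      ((lintegral_mono_set hsubQ).trans_lt hP)

/-- **The gradient half of the last step of the proof of Lemma 2.3** ("the ε-regularity theory …
implies … `|∇v(z₀)| ≤ c/r₀²`", arXiv p. 3), from Seregin 2014 Lemma 6.1 (`k = 2`) in the a.e. form
`H`: if `C(ρ; z₀) + D(ρ; z₀) < ε₀` at a scale `0 < ρ ≤ 1/4` hanging from an admissible centre,
then `|∇v| ≤ c₀₂/ρ²` a.e. on `Q_{ρ/2}(z₀)` — apply `H` to the rescaled pair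
(`isSuitableWeakSolutionInBall_rescale`), whose smallness quantity is `C(ρ; z₀) + D(ρ; z₀)`, and
transport the bound `|ρ² ∇v ∘ Φ| < c₀₂` on `Q(1/2) = Φ⁻¹(Q_{ρ/2}(z₀))` back along `Φ`.
[cite: SereginZajaczkowski2007, proof of Lemma 2.3 (last step, arXiv p. 3)] -/
theorem ae_gradient_bound_of_lemma61 {ε₀ c₀₂ : ℝ}
    (H : ∀ (U : ℝ → (EuclideanSpace ℝ (Fin 3)) → (EuclideanSpace ℝ (Fin 3))) (P : ℝ → (EuclideanSpace ℝ (Fin 3)) → ℝ) (G : ℝ → (EuclideanSpace ℝ (Fin 3)) → (EuclideanSpace ℝ (Fin 3)) →L[ℝ] (EuclideanSpace ℝ (Fin 3))),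
      IsSuitableWeakSolutionInBall 1 ((0 : ℝ), (0 : (EuclideanSpace ℝ (Fin 3)))) U P →
      HasWeakSpatialGradientOn (parabolicCylinderOpens 1 ((0 : ℝ), (0 : (EuclideanSpace ℝ (Fin 3))))) U G →
      ∫⁻ z in parabolicCylinder 1 ((0 : ℝ), (0 : (EuclideanSpace ℝ (Fin 3)))),
          (‖U z.1 z.2‖ₑ ^ (3 : ℕ) + ‖P z.1 z.2‖ₑ ^ (3 / 2 : ℝ)) < ENNReal.ofReal ε₀ →
      ∀ᵐ z ∂(volume.restrict (parabolicCylinder (1 / 2) ((0 : ℝ), (0 : (EuclideanSpace ℝ (Fin 3)))))),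
        Real.sqrt (frobeniusNormSq (G z.1 z.2)) < c₀₂)
    (hsws : IsSuitableWeakSolutionOn (shellCylOpens (3 / 4) (9 / 4) (3 / 2) (3 / 2)) 1 0 v p)
    (hG : HasWeakSpatialGradientOn (shellCylOpens (3 / 4) (9 / 4) (3 / 2) (3 / 2)) v G)
    (hA : ∃ C : ℝ≥0, ∀ᵐ t ∂(volume.restrict (Ioo (-(3 / 2 : ℝ) ^ 2) 0)),
      ∫⁻ x in shell (3 / 4) (9 / 4) (3 / 2), ‖v t x‖ₑ ^ 2 ≤ C)
    (hE : ∫⁻ z in shellCyl (3 / 4) (9 / 4) (3 / 2) (3 / 2),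
      ENNReal.ofReal (frobeniusNormSq (G z.1 z.2)) < ⊤)
    (hP : ∫⁻ z in shellCyl (3 / 4) (9 / 4) (3 / 2) (3 / 2), ‖p z.1 z.2‖ₑ ^ (3 / 2 : ℝ) < ⊤)
    (h₀ : z₀ ∈ shellCyl 1 2 1 1) (hρ : 0 < ρ) (hρ4 : ρ ≤ 1 / 4)
    (hsmall : (ENNReal.ofReal ρ ^ 2)⁻¹ *
      ∫⁻ z in parabolicCylinder ρ z₀, (‖v z.1 z.2‖ₑ ^ (3 : ℕ) + ‖p z.1 z.2‖ₑ ^ (3 / 2 : ℝ)) <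
        ENNReal.ofReal ε₀) :
    ∀ᵐ w ∂(volume.restrict (parabolicCylinder (ρ / 2) z₀)),
      Real.sqrt (frobeniusNormSq (G w.1 w.2)) ≤ c₀₂ / ρ ^ 2 := by
  have hρ2 : 0 < ρ ^ 2 := by positivity
  obtain ⟨hball, hG'⟩ := isSuitableWeakSolutionInBall_rescale hsws hG hA hE hP h₀ hρ hρ4
  have hsmall' : ∫⁻ z in parabolicCylinder 1 ((0 : ℝ), (0 : (EuclideanSpace ℝ (Fin 3)))),
      (‖(ρ • stPull (ρ ^ 2) ρ z₀.1 z₀.2 v) z.1 z.2‖ₑ ^ (3 : ℕ) +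
        ‖(ρ ^ 2 • stPull (ρ ^ 2) ρ z₀.1 z₀.2 p) z.1 z.2‖ₑ ^ (3 / 2 : ℝ)) < ENNReal.ofReal ε₀ := by
    rw [lintegral_cubic_add_pressure_sq_rescale hρ, ← ofReal_pow_inv hρ 2]
    exact hsmall
  have hae := H _ _ _ hball hG' hsmall'
  rw [← stAffine_sq_preimage_half hρ z₀] at hae
  refine ae_restrict_of_ae_restrict_preimage_stAffine hρ2 hρ z₀.1 z₀.2
    (P := fun w => Real.sqrt (frobeniusNormSq (G w.1 w.2)) ≤ c₀₂ / ρ ^ 2) ?_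
  filter_upwards [hae] with z hz
  have e : ((ρ * ρ) • stPull (ρ ^ 2) ρ z₀.1 z₀.2 G) z.1 z.2 =
      (ρ * ρ) • G (stAffine (ρ ^ 2) ρ z₀.1 z₀.2 z).1 (stAffine (ρ ^ 2) ρ z₀.1 z₀.2 z).2 := rfl
  rw [e, frobeniusNormSq_smul, Real.sqrt_mul (sq_nonneg _), Real.sqrt_sq (by positivity)] at hz
  rw [le_div_iff₀ hρ2]
  calc Real.sqrt (frobeniusNormSq (G (stAffine (ρ ^ 2) ρ z₀.1 z₀.2 z).1
        (stAffine (ρ ^ 2) ρ z₀.1 z₀.2 z).2)) * ρ ^ 2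
      = ρ * ρ * Real.sqrt (frobeniusNormSq (G (stAffine (ρ ^ 2) ρ z₀.1 z₀.2 z).1
          (stAffine (ρ ^ 2) ρ z₀.1 z₀.2 z).2)) := by ring
    _ ≤ c₀₂ := hz.le

end Rescale

end SereginZajaczkowski2007

end Literature.Analysis.FluidPDE
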